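import Mathlib
import HarnessLib
import HarnessLib.Audit
import Summits.NavierStokesRegularity.Statement
import Literature.Analysis.FluidPDE.ClassicalSolution
import Literature.Analysis.FluidPDE.LerayHopf
import Literature.Analysis.FluidPDE.SelfSimilar
import Literature.Analysis.FluidPDE.VectorCalculus
import Literature.Analysis.FluidPDE.NSWave0
import HarnessLib.Audit.Status.Attr

/-!
Route: PlaneEnergyCeiling

DORMANT since 2026-08-24T09:58:41Z (reconciler: no traction for 6.7 d (last activity item-evidence-added at 2026-08-17T16:57:41Z); parked, not closed — `ledger route dormant route-NavierStokesRegularity-PlaneEnergyCeiling --off` to reac) — unstaffed, not closed; items shared with open routes are served there. `ledger route dormant <id> --off` reactivates.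

# Route PlaneEnergyCeiling — energy cannot pile up on a plane — planar kinetic energy ceiling plus
Liouville in the planar-energy class

X = PlanarEnergyAPriori ∧ BoundedPlanarEnergyRegularity ("it suffices to show", Clay (A)-form; no
card — an original line of this standing seat). OBJECT: the
PLANAR KINETIC ENERGY of a velocity field through the plane Π = R({x₂ = c}) (R a linear isometry),
E(u;R,c) := ∫_Π |u|² dA — CRITICAL
(invariant under u ↦ λu(λx,λ²t); it is the p = ∞, q⃗ = (2,2,∞) endpoint of the anisotropic
Ladyzhenskaya–Prodi–Serrin scale, taken over ALL
directions) and AVERAGED-CONSERVED: ∫E dc = ‖u(t)‖²_{L²} ≤ 2E₀. PlanarEnergyAPriori (crux 2): along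
every classical Leray–Hopf solution from a
rapidly decaying datum on [0,T), sup over t < T, all R, all c of E(u(t);R,c) is finite.
BoundedPlanarEnergyRegularity (crux 3; the large-norm p = ∞ endpoint criterion in per-datum Clay
(A)-form; the second hypothesis of `closes`
in revs 7–15, derived INSIDE `closes` since rev 16): for a smooth divergence-free rapidly decaying
u₀,
if every classical Leray–Hopf solution from u 0 = u₀ has bounded planar energy on its interval, then
Clay (A) holds for u₀ — reached RATE-FREE
through its second layer, LOAD-BEARING in the deciding theorem since rev 16: PlanarEnergyLiouville
(crux 3, co-ranked, hypothesis of
`closes`: a bounded ancient mild solution whose planar energies are uniformly bounded is identically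
zero) + PlanarEnergyZoomA (crux 5,
hypothesis of `closes`: if (A) fails for u₀ under the planar bound, the Kato solution blows up at a
finite T* and the KNSS velocity-record
zoom, which preserves the scale-invariant planar bound by Fatou, delivers a nonzero bounded ancient
mild solution), an implication that is
pure logic. The quantitative, data-uniform form of crux 2 (the former crux 4 PlanarEnergyDataBound:
lifetime planar sup ≤ ν²Φ(P(0)/ν²) for
Schwartz-data solutions) was DROPPED at rev 16 — a stronger alternative leaf can never lie on the
deduction path of `closes` — and survives in
KILL CRITERIA / CHEAPEST FALSIFIER as the refuter's quantitative target.
Lean: `(∀ (ν T : ℝ), 0 < ν → 0 < T → ∀ (u : ℝ → EuclideanSpace ℝ (Fin 3) → EuclideanSpace ℝ (Fin 3))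
(p : ℝ → EuclideanSpace ℝ (Fin 3) → ℝ), Literature.Analysis.FluidPDE.IsClassicalNSSolutionOn
(Set.Ico 0 T) ν 0 u p → Literature.Analysis.FluidPDE.IsLerayHopfOn T ν 0 (u 0) u →
Literature.Analysis.FluidPDE.HasRapidSpatialDecay (u 0) → ∃ M : ℝ, ∀ t ∈ Set.Ico 0 T, ∀ (R :
EuclideanSpace ℝ (Fin 3) ≃ₗᵢ[ℝ] EuclideanSpace ℝ (Fin 3)) (c : ℝ), ∫⁻ y : EuclideanSpace ℝ (Fin 2),
‖u t (R (WithLp.toLp 2 ![y 0, y 1, c]))‖ₑ ^ 2 ≤ ENNReal.ofReal M) ∧ (∀ (ν : ℝ), 0 < ν → ∀ (u₀ :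
EuclideanSpace ℝ (Fin 3) → EuclideanSpace ℝ (Fin 3)), ContDiff ℝ (⊤ : ℕ∞) u₀ →
Literature.Analysis.FluidPDE.NSWave0.IsDivFree u₀ →
Literature.Analysis.FluidPDE.HasRapidSpatialDecay u₀ → (∀ (T : ℝ), 0 < T → ∀ (u : ℝ → EuclideanSpace
ℝ (Fin 3) → EuclideanSpace ℝ (Fin 3)) (p : ℝ → EuclideanSpace ℝ (Fin 3) → ℝ),
Literature.Analysis.FluidPDE.IsClassicalNSSolutionOn (Set.Ico 0 T) ν 0 u p →
Literature.Analysis.FluidPDE.IsLerayHopfOn T ν 0 (u 0) u → u 0 = u₀ → ∃ M : ℝ, ∀ t ∈ Set.Ico 0 T, ∀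
(R : EuclideanSpace ℝ (Fin 3) ≃ₗᵢ[ℝ] EuclideanSpace ℝ (Fin 3)) (c : ℝ), ∫⁻ y : EuclideanSpace ℝ (Fin
2), ‖u t (R (WithLp.toLp 2 ![y 0, y 1, c]))‖ₑ ^ 2 ≤ ENNReal.ofReal M) → ∃ (u : ℝ → EuclideanSpace ℝ
(Fin 3) → EuclideanSpace ℝ (Fin 3)) (p : ℝ → EuclideanSpace ℝ (Fin 3) → ℝ),
Literature.Analysis.FluidPDE.IsSmoothOnHalfSpace u ∧
Literature.Analysis.FluidPDE.IsSmoothOnHalfSpace p ∧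
Literature.Analysis.FluidPDE.IsNavierStokesSolution ν 0 u₀ u p ∧
Literature.Analysis.FluidPDE.HasBoundedEnergy u)`

## Assembly
Pure logic over the definition modules only (no frame theorem, no Theorems import), certified
natively by the gate (rev 16) and in the
planner's Sketch.lean / Closes3.lean (lean check rc 0, 0 sorry, axioms
propext/Classical.choice/Quot.sound). `Target ↔ PlanarEnergyAPriori ∧
BoundedPlanarEnergyRegularity` is Iff.rfl (X unchanged since rev 11); the deciding theorem proves X
→ Statement one layer deeper:
`theorem closes (h₁ : PlanarEnergyAPriori) (h₃ : PlanarEnergyLiouville) (h₅ : PlanarEnergyZoomA) :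
NavierStokesRegularity` — FIRST
`have h₂ : BoundedPlanarEnergyRegularity` by contradiction (fix ν and a Clay datum u₀ with the
planar bound along every classical Leray–Hopf
solution from u₀; if Clay (A) failed, h₅ yields a bounded ancient mild solution, measurable, jointly
smooth, with uniformly bounded planar
energies and v ≢ 0, and h₃ forces v ≡ 0), THEN datum by datum h₁ supplies the planar bound on every
[0,T) (HasRapidSpatialDecay (u 0) by
rewriting u 0 = u₀) and h₂ turns it into Clay (A) for u₀. Kernel cone (HarnessLib closesCone, rev
16): binders PlanarEnergyAPriori,
PlanarEnergyLiouville, PlanarEnergyZoomA; BoundedPlanarEnergyRegularity in cone through the proof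
term (crux 3, claimable directly — a direct
proof lets tenure re-glue `closes` to the 2-hypothesis form of revs 7–15); the support glue
BoundedRegularityOfLiouvilleZoomA
(PlanarEnergyLiouville → PlanarEnergyZoomA → BoundedPlanarEnergyRegularity, provable now, the same
four lines) marks it `derived` once landed.
Carried items, outside the kernel cone by design (lemmas toward cruxes 2/3, to be landed and cited
`--supports`): PlanarEnergyZoom (the
extension-form core of PlanarEnergyZoomA), SlabEnergyIdentity, ScaledEnergyOfPlanar,
SteadyPlanarLiouville; Target and Assembly mirror X and
`closes`. Repair log: revs 2–3 took PlanarEnergyZoom as a third hypothesis; revs 4–6 (glue repair)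
made `closes` "X suffices" with the
extension-form BoundedPlanarEnergyNoBlowup and the INVOKED frame theorem
typeICertificateLadder_noBlowupToClay_proof; revs 7–12 (cone repair)
moved X to the A-form so that `closes` needs no frame theorem, dropped the
Theorems.TypeICertificateLadderNoBlowupToClay import through which all
26 unproved named facts of the module cone entered (none was used: gate constant cone 0 unproved),
and dropped the superseded
BoundedPlanarEnergyNoBlowup and this route's copy of the shared frame NoBlowupToClay (stmt-15607);
revs 14–16 (unused-crux repair): backward
glue items `Crux → hypothesis` do not enter the gate's FORWARD cone, so the second layer was made
load-bearing in `closes` (PlanarEnergyZoomA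
support→crux, rank 5), PlanarEnergyDataBound (stmt-16857) and its rev-14 glue APrioriOfDataBound
(stmt-17967) were dropped, and the Assembly
was restated to PlanarEnergyAPriori → PlanarEnergyLiouville → PlanarEnergyZoomA →
NavierStokesRegularity.

Rationale: WHY THIS LINE. ENGINE (support SlabEnergyIdentity, a pure integration-by-parts identity checked by
hand this session): integrating the local energy
EQUALITY ∂ₜ(|u|²/2) + div((|u|²/2+p)u) = νΔ(|u|²/2) − ν|∇u|² over a plane kills every in-plane
divergence and leaves an EXACT 1-D viscous
conservation law in the offset c, ∂ₜE = ν∂²_cE − 2∂_cF − 2νD, with a SIGNED SINK D = ∫_Π|∇u|² ≥ 0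
and a single unsigned term that is a
c-DERIVATIVE of the Bernoulli flux F(c) = ∫_Π(|u|²/2+p)uₙ dA; E(·,t) is a-priori in L¹(dc) (the
energy) and the ℓ-smoothed flux has a-priori
bounded signed time-integrals |∫F_ℓ dt| ≤ E₀(2 + cνΔt/ℓ²) (local energy equality tested with a
smoothed Heaviside), so planar energy can
grow ONLY by flux convergence onto one plane against 1-D diffusion and dissipation — the content of
crux 2 is "kinetic energy cannot pile up
on a codimension-1 set", the plane analogue of the point-concentration exclusions
(CaffarelliKohnNirenberg1982; arXiv:1108.1165 §9).
FREE STRUCTURE (support ScaledEnergyOfPlanar, a ball lies in a slab): a planar ceiling P gives the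
Caffarelli–Kohn–Nirenberg/Seregin scaled
kinetic energy sup_{x,r,t} r⁻¹∫_{B_r(x)}|u|² ≤ 2P at EVERY centre and scale, i.e. u ∈ L^∞_t Ṁ^{2,3}:
crux 2 alone puts any singularity in
the Type-I-in-energy class (Choe–Yang arXiv:1705.04561 Thm 1: reverse Hölder for ∇u;
SereginSverak2009), and the planar log-gain excludes
the |y|⁻¹ far-field germ of every (discretely) self-similar profile (its planar energy through the
centre is log-divergent), exactly as
L³ does in EscauriazaSereginSverak2003 — but L³ has no balance law and E has one. REGULARITY SIDE:
the Liouville crux lives in a NEW class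
— bounded ancient mild solutions with L²-on-every-plane velocity — strictly weaker than KNSS (L)
(KNSS2009: constants and the parasitic
drifts b(t) have infinite planar energy and are excluded by hypothesis, cf. the FiniteTangentModuli
refutation in the negatives index),
with its STEADY corner already a theorem (bounded steady solutions in Ṁ^{2,3} vanish:
Chamorro–Jarrín–Lemarié-Rieusset arXiv:1806.03003
Prop 3.1 + Thm 1; Tsai arXiv:2005.09691 Thm 1.1(a) with δ = 1; Cho–Neustupa–Yang 2024 p = 2), its
2-D and axisymmetric-no-swirl corners
KNSS, its finite-energy corner elementary (energy decay + pigeonholed small-L³ slice + weak–strong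
uniqueness). Imported areas: anisotropic
/mixed-norm LPS theory (Zheng, Phan, Wang–Wu–Zhou arXiv:1901.01510 Cor 1.2(2): the SMALL-norm
ε-regularity at Σ1/q_j = 1, p = ∞),
Morrey-space Liouville theory for steady NS, CKN scaled-energy partial regularity, 1-D parabolic
conservation laws. What no prior route
does: an exactly conserved-in-average critical quantity of the VELOCITY (not vorticity) whose
evolution is a conservation law with signed
sink, and a Liouville class with a proved steady case; nearest route SlicedKelvin (an earlier
generation of this seat) slices vorticity FLUX with a Kato/fold
law (interior creation term, Constantin L¹ budget, Biot–Savart velocity bound, L¹-on-planes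
Liouville whose steady case is open) — here
no Kato inequality, no Biot–Savart, no nodal sets: the local energy equality itself is the law.

RANKED CRUXES. #0 Target (target) — X = PlanarEnergyAPriori ∧ BoundedPlanarEnergyRegularity (Clay
(A)-form; Iff.rfl; since rev 16 `closes` proves X → Statement one layer deeper, from
PlanarEnergyAPriori and the second layer PlanarEnergyLiouville + PlanarEnergyZoomA of the second
conjunct): (i) every classical Leray–Hopf solution from a rapidly decaying datum on [0,T) has planar
kinetic energy bounded over all planes and all t < T; (ii) for every ν > 0 and every smooth
divergence-free rapidly decaying u₀, if every classical Leray–Hopf solution from u 0 = u₀ has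
bounded planar energies on its interval (every T), then Clay (A) holds for u₀. (why it might fail:
(i) is a critical a-priori bound: Type-II blow-up (diverging local Reynolds number) or a collapsing
energy SHEET fed by colliding streams would break it; (ii) contains an unproved Liouville theorem in
the Ṁ^{2,3}-type class where Type-I profiles almost live.) [KNSS2009, CaffarelliKohnNirenberg1982,
EscauriazaSereginSverak2003, arXiv:1705.04561, arXiv:1806.03003, Fefferman2000]
#2 PlanarEnergyAPriori (crux) — PLANAR ENERGY CEILING (per-solution form): for every ν > 0, T > 0
and every classical solution (u,p) of unforced NS on ℝ³×[0,T) that is Leray–Hopf from a rapidly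
decaying datum u(0), there is M with ∫_{R({x₂=c})} |u(t)|² dA ≤ M for all t ∈ [0,T), all linear
isometries R and all heights c. By the slab law it suffices to control the convergence −∂_cF of the
Bernoulli flux at the maximising plane against ν∂²_cE and the sink 2νD (attack: split F into the
a-priori-bounded smoothed flux ledger plus an oscillation paid by planar dissipation; a peak of
height E* has width ≤ 2E₀/E*, so it must be fed through a slab thinner than the parabolic scale).
[difficulty: open-problem] (why it might fail: critical a-priori estimate that already implies
Type-II exclusion in the scaled-energy sense (forces u ∈ L^∞_t Ṁ^{2,3}); a Type-II singularity, or
energy focusing onto a sheet by colliding jets faster than viscosity thickens it (ring collision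
pumps Γ²R/h), breaks it.) [CaffarelliKohnNirenberg1982, arXiv:1108.1165, arXiv:1705.04561,
SereginSverak2009, Hou2022PotentiallySingularNS, LemarieRieusset2016]
#3 PlanarEnergyLiouville (crux) — LIOUVILLE IN THE PLANAR-ENERGY CLASS: a bounded ancient mild
solution v of NS (ν = 1) on ℝ³×(−∞,0) (KNSS duality-form class IsBoundedAncientMildSolution 1 v,
measurable slices), jointly smooth on (−∞,0)×ℝ³, whose planar kinetic energies ∫_{R({x₂=c})}|v(t)|²
dA are bounded uniformly in t, R, c, is identically zero. Weaker than KNSS (L) (stmt-10661):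
constants and parasitic drifts are excluded by the hypothesis; free structure: v ∈ L^∞_t Ṁ^{2,3}
with |v| ≤ C, |y|⁻¹ far-field germs excluded (log-divergent planar energy), steady corner PROVED
(bounded + Ṁ^{2,3} steady ⇒ 0), 2-D / axisymmetric-no-swirl corners KNSS, finite-energy corner
elementary. [difficulty: open-problem] (why it might fail: bounded planar energy gives
Ṁ^{2,3}-boundedness but no smallness at infinity, so the time-dependent case is a Type-I-type
Liouville problem; a bounded ancient two-sided jet fed from infinity with L² cross-sections, or a
Type-I ancient flow with sub-|y|⁻¹ planar tails, refutes it.) [KNSS2009, SereginSverak2009,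
arXiv:1806.03003, arXiv:2005.09691, AlbrittonBarker2019]
#3 BoundedPlanarEnergyRegularity (crux, co-ranked 3; the second hypothesis of `closes` in revs 7–15,
derived INSIDE `closes` from cruxes 3 + 5 since rev 16 and still claimable for a direct proof) —
BOUNDED PLANAR ENERGY ⇒ CLAY REGULARITY, (A)-FORM (per datum; the large-norm p = ∞ endpoint of the
anisotropic LPS scale over all directions, stated so that the deciding theorem needs no frame
theorem): for every ν > 0 and every smooth, divergence-free, rapidly decaying datum u₀ — if every
classical solution (u,p) of unforced NS on ℝ³×[0,T) that is Leray–Hopf from u 0 = u₀ has planar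
kinetic energies bounded uniformly in t < T, R, c (every T > 0), then Clay (A) holds for u₀ (u, p
smooth on ℝ³×[0,∞) solving NS from u₀ with bounded energy). Content = the extension-form criterion
"bounded planar energy on [0,T) ⇒ smooth extension past T" (BoundedPlanarEnergyNoBlowup of revs
4–11, dropped at rev 12 as superseded; its text is the extension-form reading of (ii)) + the
per-datum local Clay theory (Kato classical Leray–Hopf solution from Fefferman data, C^∞ up to t =
0, blow-up alternative, energy inequality — proved in tree as part of stmt-0055, but only inside
cone-dirty modules). Reached through its second layer PlanarEnergyLiouville → PlanarEnergyZoomA →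
BoundedPlanarEnergyRegularity (pure logic, load-bearing in `closes` since rev 16 and filed as the
support glue BoundedRegularityOfLiouvilleZoomA); a direct ESS-type attack (backward uniqueness +
unique continuation) needs decay across planes that the planar class does not give. [deps:
PlanarEnergyLiouville, PlanarEnergyZoomA] [difficulty: open-problem] (why it might fail: A-form of
the large-norm p = ∞ endpoint: a planar bound gives bounded CKN scaled energy but no smallness or
decay across planes, so it contains the OPEN Type-I-in-energy exclusion (planar log-gain only) and
the Liouville crux; a blow-up from Fefferman data with bounded planar energies kills it.)
[arXiv:1901.01510, KNSS2009, AlbrittonBarker2019, SereginSverak2009, EscauriazaSereginSverak2003,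
Fefferman2000]
#5 PlanarEnergyZoomA (crux, rank 5; hypothesis of `closes` since rev 16 — filed rev 7 as a rank-5
crux, support during revs 12–15 while BoundedPlanarEnergyRegularity was the closing hypothesis) —
VELOCITY-RECORD ZOOM, CLAY (A)-FORM (second-layer partner of PlanarEnergyLiouville under
BoundedPlanarEnergyRegularity): for ν > 0 and a smooth divergence-free rapidly decaying u₀, if every
classical Leray–Hopf solution from u 0 = u₀ has bounded planar energies on its interval and Clay (A)
FAILS for u₀, then there is a bounded ancient mild solution v (ν = 1), measurable, jointly smooth on
(−∞,0)×ℝ³, with uniformly bounded planar energies and v ≢ 0. Route: the Kato solution from u₀ is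
classical Leray–Hopf, C^∞ up to t = 0, with bounded energy, so ¬(A) forces a finite maximal time T*
with sup|u| → ∞; the planar bound holds on [0,T*) by hypothesis; then PlanarEnergyZoom (KNSS Prop
6.1 zoom at near-record points, ν normalised to 1, planar Fatou). = PlanarEnergyZoom + the per-datum
local Clay theory. [difficulty: L] (why it might fail: load-bearing AS TYPED: the Kato solution from
Fefferman data must be C^∞ up to t = 0 with the IsNavierStokesSolution pressure, and the
duality-form mild identity, joint smoothness and the planar bound on EVERY plane (Fatou) must
survive the KNSS record zoom; in tree only KNSS Prop 6.1.) [KNSS2009, SereginSverak2009,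
AlbrittonBarker2019, Fefferman2000, Kato1984]
#9 PlanarEnergyZoom (support) — VELOCITY-RECORD ZOOM AT BOUNDED PLANAR ENERGY, extension form (the
solution-level core of PlanarEnergyZoomA; NOT a hypothesis of `closes`): if a classical Leray–Hopf
solution from a rapidly decaying datum has no smooth extension past T while its planar energies stay
≤ M on [0,T), then (bounded velocity ⇒ extension, in-tree hasSmoothExtensionPast_of_bounded_holds,
so velocity records diverge) the KNSS zoom at near-record points (KNSS2009 Prop 6.1, in tree as
KNSS2009_blowup_generates_ancient / IsKNSSBlowupLimit), after normalising ν = 1 by u ↦ ν⁻¹u(x,t/ν),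
yields a bounded ancient mild solution v (ν = 1), measurable and jointly smooth, with sup|v| = 1
(hence v ≢ 0) and planar energies ≤ M/ν² on every plane and slice (exact scale invariance of E +
Fatou under locally uniform convergence). [difficulty: L] [KNSS2009, SereginSverak2009,
AlbrittonBarker2019]
#9 SlabEnergyIdentity (support) — THE SLAB ENERGY IDENTITY (provable now; a kinematic identity, no
NS solution and no pressure Poisson equation needed): for any real ν, any a < b, any smooth rapidly
decaying divergence-free u and smooth rapidly decaying scalar p on ℝ³, with the tendency field acc
:= νΔu − (u·∇)u − ∇p, flux F(c) := ∫_{x₂=c}(|u|²/2 + p)u₂ dA and boundary term B(c) :=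
∫_{x₂=c}⟪u,∂₂u⟫ dA: ∫_{a<x₂<b} 2⟪u,acc⟫ dx = 2ν(B(b) − B(a)) − 2ν∫_{a<x₂<b}|∇u|² dx − 2(F(b) −
F(a)). Along a classical solution ∂ₜ|u|² = 2⟪u,acc⟫, so this is the integrated form of ∂ₜE = ν∂²_cE
− 2∂_cF − 2νD. [difficulty: provable-now] [CaffarelliKohnNirenberg1982, LemarieRieusset2016,
MajdaBertozzi2002]
#9 ScaledEnergyOfPlanar (support) — PLANAR CEILING ⇒ SCALED-ENERGY CEILING (provable now): if a
continuous field w on ℝ³ has planar energy ≤ M through every plane, then ∫_{B_r(x₀)}|w|² ≤ 2rM for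
every centre and radius (the ball lies in the slab |x₂ − (x₀)₂| < r; Tonelli over the coordinate
foliation). Hence bounded planar energy along a solution means uniformly bounded CKN quantity A(r)
at all centres and scales — the hypothesis of Choe–Yang's reverse-Hölder theorem and of Seregin's
Type-I-in-energy class. [difficulty: provable-now] [arXiv:1705.04561, CaffarelliKohnNirenberg1982,
SereginSverak2009]
#9 SteadyPlanarLiouville (support) — THE STEADY CORNER OF CRUX 3 (provable from the literature): a
smooth bounded divergence-free steady solution w of (w·∇)w + ∇q = Δw on ℝ³ whose planar energies are
bounded on every plane is identically zero — by ScaledEnergyOfPlanar w ∈ Ṁ^{2,3}, and bounded +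
Ṁ^{2,3} steady solutions vanish (Chamorro–Jarrín–Lemarié-Rieusset arXiv:1806.03003 Prop 3.1: w ∈ Ḣ¹
with ‖w‖_{Ḣ¹} ≲ ‖w‖^{1/2}_∞‖w‖_{Ṁ^{2,3}}, then w ∈ L⁴ and their Thm 1; alternatively Tsai
arXiv:2005.09691 Thm 1.1(a) with δ = 1, q = 12/5, since R⁻¹‖w‖²_{L^{12/5}(R<|x|<2R)} ≲ R^{-1/6} →
0). [difficulty: M] [arXiv:1806.03003, arXiv:2005.09691, Seregin2016]
#9 BoundedRegularityOfLiouvilleZoomA (support) — GLUE, the second layer made explicit: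
PlanarEnergyLiouville → PlanarEnergyZoomA → BoundedPlanarEnergyRegularity (pure logic by
contradiction — under ¬(A) the zoom's nonzero bounded ancient mild solution with bounded planar
energies is killed by the Liouville theorem; certified in the planner's Sketch.lean, axioms
propext/Classical.choice/Quot.sound; the same four lines sit inside `closes`). Once landed, the
gate's kernel cone marks BoundedPlanarEnergyRegularity `derived`. [difficulty: provable-now]
[KNSS2009, AlbrittonBarker2019, SereginSverak2009]
DROPPED AT REV 12 (cone repair; recorded here so nobody re-files them): NoBlowupToClay
(stmt-NavierStokesRegularity-15607, this route's copy of the shared frame stmt-0055, PROVED in tree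
as Theorems.typeICertificateLadder_noBlowupToClay_proof /
Theorems.navierStokesRegularity_of_noBlowup) — no longer invoked by `closes`, and a gate-written
`_holds` link for it would import a proof module whose import closure carries 26–31 unproved named
facts (blocked-by-cone); BoundedPlanarEnergyNoBlowup (stmt-NavierStokesRegularity-16899, extension
form of (ii)) — superseded 1:1 in role by BoundedPlanarEnergyRegularity; proving it remains
meaningful mathematics (it is (ii) minus the local theory) but it is not an obligation of this
route.
DROPPED AT REV 16 (unused-crux repair; recorded so nobody re-files it as a crux of THIS route — a
stronger, data-uniform sufficient condition for crux 2 is an alternative leaf outside the forward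
cone of `closes`; if wanted it is a separate route sharing PlanarEnergyAPriori, and it stays the
refuter's quantitative target of KILL CRITERIA): PlanarEnergyDataBound
(stmt-NavierStokesRegularity-16857; with its rev-14 glue APrioriOfDataBound,
stmt-NavierStokesRegularity-17967, `PlanarEnergyDataBound → PlanarEnergyAPriori` by the decay lemma
'rapid decay ⇒ finite energy and planar energies bounded over all planes') — QUANTITATIVE CEILING
(the falsifiable, data-uniform form of crux 2; what a proof through the slab law would deliver): for
every ν > 0, T > 0 and A there is M = M(ν,T,A) such that every classical Leray–Hopf solution on
[0,T) from a rapidly decaying datum with ∫|u₀|² ≤ A and initial planar energy ≤ A on every plane has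
planar energy ≤ M on every plane for all t < T. NS scaling makes the energy constraint nearly
vacuous for concentrated data, so M is really a function of the planar Reynolds number A/ν²; by
Tao's compactness equivalences (arXiv:1108.1165) a per-solution bound of this type is expected to
upgrade to the uniform one. [deps: PlanarEnergyAPriori] [difficulty: open-problem] (why it might
fail: uniform in rough data norms: if regular flows at FIXED planar Reynolds number A/ν² can pump
mid-plane energy by an unbounded factor before T (ring/jet collisions whose viscous saturation is
not Reynolds-controlled), the uniform bound dies while the per-solution crux 2 survives.)
[arXiv:1108.1165, LemarieRieusset2016, Hou2022PotentiallySingularNS, MajdaBertozzi2002]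

TWO-LAYER PLAN. INSTALLED (rev 16): BoundedPlanarEnergyRegularity ⇐ PlanarEnergyLiouville →
PlanarEnergyZoomA → BoundedPlanarEnergyRegularity — pure logic, now the
first step of `closes` itself (hypotheses PlanarEnergyAPriori, PlanarEnergyLiouville,
PlanarEnergyZoomA) and the support glue item BoundedRegularityOfLiouvilleZoomA;
no `--split` is needed (split children would not enter the gate's forward cone either), and a direct
proof of BoundedPlanarEnergyRegularity lets tenure re-glue
`closes` to the 2-hypothesis form (PlanarEnergyAPriori, BoundedPlanarEnergyRegularity) of revs 7–15.
Foreseen glued splits (not filed as splits): PlanarEnergyZoomA ⇐ PlanarEnergyZoom (extension-form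
zoom) + LocalClayTheoryA (per datum: the Kato classical Leray–Hopf solution from a
Fefferman datum is C^∞ up to t = 0 with bounded energy, and either exists for all time — giving (A)
— or loses boundedness at a finite T*;
provable now, proved in tree only inside cone-dirty modules, so its cone-clean proof or the
discharge of those modules' facts is the one
place where that price is paid); PlanarEnergyAPriori ⇐ FluxLedger (|∫F_ℓ dt| ≤ E₀(2 + cνΔt/ℓ²) for
the ℓ-smoothed Bernoulli flux,
provable now from the local energy equality) → FluxConvergenceBudget (sup_t ∫₀ᵗ (ν(t−τ))^{-1/2}
sup_c |F(c,τ) − F_ℓ(c,τ)| dτ < ∞ at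
ℓ = parabolic scale, the real crux) → PlanarEnergyAPriori; PlanarEnergyLiouville ⇐
SteadyPlanarLiouville (proved corner) →
BlowDownPlanarLiouville (ancient solutions whose backward blow-down is (discretely) self-similar:
planar-L² kills the −1-homogeneous germ,
then an ε-regularity-at-infinity step) → PlanarEnergyLiouville; PlanarEnergyZoom ⇐ record extraction
→ planar Fatou → PlanarEnergyZoom
(k ≤ 3, depth 1 each).

KILL CRITERIA. A bounded ancient mild solution with bounded planar energies that is not identically
zero refutes PlanarEnergyLiouville (close
`refuted:PlanarEnergyLiouville` unless the witness is excluded by extra structure zoom limits carry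
— sup|v| = 1 attained, Ṁ^{2,3} with
constant 2M — then pivot crux 3 to the zoom-limit subclass). A blow-up from a Fefferman datum with
bounded planar energies along its classical Leray–Hopf solution refutes
BoundedPlanarEnergyRegularity (in the cone of `closes`) and with it PlanarEnergyLiouville ∧
PlanarEnergyZoomA: the route closes `refuted:BoundedPlanarEnergyRegularity`.
PlanarEnergyZoomA (a hypothesis of `closes` since rev 16) or PlanarEnergyZoom failing AS TYPED (e.g.
the duality-form mild identity or joint smoothness not surviving the
record zoom, or the Kato solution's smoothness up to t = 0 mistyped) formally BREAKS the route but
is a re-typing, not a kill: repair by `--restate PlanarEnergyZoomA`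
or by re-gluing `closes` to (PlanarEnergyAPriori, BoundedPlanarEnergyRegularity) — the criterion
crux stands on its own. A smooth bounded-data family with planar energy
unbounded before a fixed T at fixed planar Reynolds number A/ν² kills only the quantitative form of
crux 2 (former crux 4 PlanarEnergyDataBound, dropped at rev 16; still the
refuter's cheapest quantitative target) and leaves the per-solution crux 2 intact; a blow-up with
planar energy → ∞ (Type II, or
Type I with the |y|⁻¹ scar) refutes crux 2 = ¬A. NoBlowup proved elsewhere (TypeILiouville target,
stmt-0054) moots the route; KNSS (L)
proved elsewhere closes crux 3 at once; NoTypeII (stmt-0056) proved elsewhere leaves crux 2 with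
only its planar log-gain to show.

NOT DECOMPOSED YET. The flux-convergence budget itself (ledger/oscillation split of F at the
maximising plane, the parabolic-scale choice of ℓ, the role of
the sink 2νD on the same plane) — children of crux 2 once SlabEnergyIdentity and FluxLedger land;
the time-dependent part of crux 3
(blow-down classification, ε-regularity at infinity in the planar-L² class) and its relation to
Seregin's Type-I-in-energy conjecture and
to VorticityPace's (L)+pace crux; the compactness bookkeeping of PlanarEnergyZoom (planar Fatou
under the KNSS extraction), the cone-clean per-datum local Clay theory inside
PlanarEnergyZoomA, and any direct, Liouville-free proof of BoundedPlanarEnergyRegularity; the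
corners
(2-D, axisymmetric no swirl, finite energy) as calibration lemmas; the definition request
planarEnergy (inlined in every item for now).

CHEAPEST FALSIFIER. (i) Literature lookup, run this session: is the p = ∞ mixed-norm criterion
"sup_t sup_planes ∫_Π|u|² < ∞ ⇒ regular" already proved
(it would make BoundedPlanarEnergyRegularity — hence crux 3 + zoom — `known` modulo the local theory
and leave crux 2 alone)? Found only the SMALL-norm ε-regularity version (Wang–Wu–Zhou
arXiv:1901.01510 Cor 1.2(2), Σ1/q_j = 1 at p = ∞) and mixed-norm well-posedness (Phan) — the
large-norm endpoint is not in print. (ii)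
Numerics a refuter can run (kit): track P(t) = sup over the three coordinate foliations of planar
energy against ‖u‖_∞ and ‖ω‖_∞ in (a)
head-on vortex-ring collision at Re_Γ = 500…4000 (Γ²R/h pumping, viscous saturation — does max_t
P/P₀ grow like a power of Re_Γ? a bounded
or logarithmic law supports the quantitative form of crux 2 (former crux 4), a clean power law is
consistent with it, growth without saturation before reconnection
kills that form and steers the crux-2 attack away from data-uniform bounds),
(b) Hou's interior axisymmetric scenario (arXiv:2107.06509): P through z = 0 and through meridional
planes — P saturating while ‖u‖_∞ grows
without bound would CONTRADICT BoundedPlanarEnergyRegularity in that scenario. (iii) In-Lean: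
SlabEnergyIdentity and ScaledEnergyOfPlanar are
provable now; a failure of either as typed is a typing bug, not a kill.

NUMBERS. Planar energy E has dimension L⁰ (ν = 1 units); ∫E dc = ‖u‖₂² ≤ 2E₀ (dimension L¹); a peak
of height E* has width ≤ 2E₀/E*. Type-I
profile |u| ≈ c/|x| on the blow-up slice ⇒ E(plane through x₀) ≈ 2πc² log(L/√(ν(T−t))) → ∞ (log),
spherical energies ∫_{S_r}|u|² stay
O(c²) (so planes, not spheres, are the detector); Bernoulli flux of a Type-I profile F ~
(T−t)^{-1/2}, ∂_cF ~ (T−t)^{-1}, consistent with the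
log. Planar ceiling P ⇒ r⁻¹∫_{B_r}|u|² ≤ 2P (Choe–Yang hypothesis M = 2P; their δ₀ = 2/(CM^{5/9} −
1)). Steady Liouville inputs: Galdi L^{9/2};
Seregin 2016 Ṁ^{2,6} ∩ Ṁ^{3/2,3}; CJL 2020 Ṁ^{2,3} ∩ Ṁ^{2,q} and bounded ∩ Ṁ^{2,3}; Tsai 2021 Thm
1.1(a) q(1) = 12/5; Cho–Neustupa–Yang 2024
p ∈ (3/2,3) with ratio R^{2/p−1/3} (p = 2: R^{2/3} vs our R^{1/2}). Smoothed flux ledger: |∫F_ℓ dt|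
≤ E₀(2 + cνΔt/ℓ²). Items at open: 10
(target, assembly, 3 cruxes, 5 supports); after the glue repair (revs 4–6): 11; after the cone
repair (revs 7–12): 11 ACTIVE — target,
assembly, 4 cruxes (PlanarEnergyAPriori 2, PlanarEnergyLiouville 3, BoundedPlanarEnergyRegularity 3,
PlanarEnergyDataBound 4), 5 supports
(PlanarEnergyZoom, PlanarEnergyZoomA, SlabEnergyIdentity, ScaledEnergyOfPlanar,
SteadyPlanarLiouville); dropped: NoBlowupToClay (15607),
BoundedPlanarEnergyNoBlowup (16899); after the unused-crux repair (revs 14–16): 11 ACTIVE — target,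
assembly, 4 cruxes (PlanarEnergyAPriori 2, PlanarEnergyLiouville 3,
BoundedPlanarEnergyRegularity 3, PlanarEnergyZoomA 5; `closes` takes 2, 3 = Liouville, 5), 5
supports (PlanarEnergyZoom, SlabEnergyIdentity, ScaledEnergyOfPlanar,
SteadyPlanarLiouville, BoundedRegularityOfLiouvilleZoomA); dropped: PlanarEnergyDataBound (16857),
APrioriOfDataBound (17967). CONE HYGIENE (for provers; priority guardrail blocked-by-cone): the
route file imports only the definition
modules ClassicalSolution, LerayHopf, SelfSimilar, VectorCalculus, NSWave0 (module closure 24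
project modules; gate constant cone 0 unproved);
a Theorems file proving an item of this route should not import Theorems.NoBlowupToClay /
Theorems.TypeICertificateLadderNoBlowupToClay /
Theses.TypeICertificateLadder or the proof modules behind them (31 / 26 unproved named facts in
their module closures: Axisymmetric.{elgindi_euler_blowup,
chen_hou_blowup}, PartialRegularity.{TypeISingularityExists, tao_quantitative_ess, …},
NSLerayHopf.{LerayHopfNonUniqueness, …}, LocalTypeI.*,
GKPCriticalElements.gkp_*, MildSolutions.RusinSverakQuestion, ESSBackwardUniquenessC1,
CKN1982.proposition2, …), because the gate's `_holds` link
imports the proving module into this file; by-name check of the SelfSimilar/MildSolution closure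
found 3 closed named facts without a same-name
`_holds` (IsMildNSSolutionBetween.nsRescale, IsMildNSSolutionBetween.trans,
IsMildNSSolutionOn.isWeakNSSolutionOn — FabesJonesRiviere/Kato
technical lemmas, M-sized) which, if the census counts them, are this route's entire residual
module-cone debt (needs-fact candidates, tier 0).

DEFINITION REQUESTS. None blocking: every item is stated inline over
Literature.Analysis.FluidPDE.{IsClassicalNSSolutionOn, IsLerayHopfOn, HasRapidSpatialDecay,
HasSmoothExtensionPast, IsBoundedAncientMildSolution, IsSmoothOnHalfSpace, IsNavierStokesSolution,
HasBoundedEnergy, NSWave0.IsDivFree (the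
summit-grade Clay glue predicates), VectorCalculus.IsDivFree, convect} + Mathlib (lintegral over
EuclideanSpace ℝ (Fin 2),
LinearIsometryEquiv, Laplacian.laplacian, gradient, set integrals). Wanted later (convenience,
`--kind definition --topic
Summits/NavierStokesRegularity/NavierStokesRegularity/Theorems`): planarEnergy u R c := ∫⁻ y, ‖u (R
(y₀,y₁,c))‖ₑ² and bernoulliFlux u p R c.
Literature wants open (not blocking): acq-02026 (Cho–Neustupa–Yang, Nonlinearity 37 (2024) 035007 —
the p = 2 steady Liouville; Tsai
arXiv:2005.09691 and CJL arXiv:1806.03003 already cover the bounded steady corner).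

Novelty: Searches (2026-08-16): grep of all 69 thesis files and 157 idea cards of the sub for "planar
energy|slab energy|half-space energy|energy
flux through|mixed norm|anisotropic Lebesgue|Morrey M^{2,3}" (0 hits); `lit search --source arxiv
"anisotropic Lebesgue Navier-Stokes
regularity"` (4: arXiv:1901.01510 Wang–Wu–Zhou, arXiv:2006.05785 Ragusa–Wu, arXiv:2205.13893,
arXiv:2002.02152 Miller); `lit search
--source arxiv "Liouville stationary Navier-Stokes growth"` (6: arXiv:1811.09051, 2402.11144
Bang–Yang, 2501.04372 Cho–Yang, 1805.08513,
1903.05989, 2601.04622); `"Sufficient conditions Liouville steady Navier-Stokes"` (2: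
arXiv:1805.02227 Seregin–Wang, arXiv:1604.07643
Chae–Wolf); `"Liouville stationary Navier-Stokes Morrey spaces"` (5: arXiv:1806.03003 CJL,
1903.00601 Jarrín, …); crossref "Liouville …
MHD Hall-MHD" (10: doi:10.1088/1361-6544/ad1efc Cho–Neustupa–Yang 2024,
doi:10.1007/s42985-020-00056-6 Tsai 2021, …); crossref/arXiv
Choe–Yang (arXiv:1705.04561, read Thm 1–2); `lit read` arXiv:2501.04372 pp.1–3, arXiv:2005.09691 p.3
(Thm 1.1), arXiv:1806.03003 pp.3,9,11
(Thm 2–3, Prop 3.1), arXiv:1901.01510 pp.3–4 (Thm 1.1, Cor 1.2, Thm 1.4); `lit search --hybrid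
"kinetic energy on planes slab energy flux
Navier-Stokes blow-up"` (10 book hits, none relevant); `lit galaxy search "kinetic energy on a
plane" --star all` (2, CFD textbook/irrelevant),
`"energy flux through a plane" --star all` (6, engineering), `"Morrey space M^{2,3}" --star all`
(0); `lit frontier NavierStokesRegulari  [refs: 10.1088/1361-6544/ad1efc, 10.1007/s42985-020-00056-6, 1901.01510, 2006.05785, 2205.13893, 2002.02152, 1811.09051, 1805.02227, 1604.07643, 1806.03003, 1705.04561, 2501.04372, 2005.09691, doi:10.1088/1361-6544/ad1efc, doi:10.1007/s42985-020-00056-6, KNSS2009]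

Barriers (technique_class: planar-energy-law, mixed-lps-endpoint, liouville): - technique_class: planar-energy-law, mixed-lps-endpoint, liouville
- Literature.Barriers.NavierStokesRegularity.TaoAveragedBlowup: evaded in kind — the slab law is the
LOCAL ENERGY EQUALITY (pointwise
Leibniz structure of (u·∇)u + ∇p giving the divergence form div((|u|²/2+p)u)), which Tao's averaged
bilinear forms do not possess (no local
energy flux); an argument through crux 2 cannot prove the false averaged statement; the bet is that
the 1-D conservation form can be made
quantitative (flux-convergence budget).
- Literature.Barriers.NavierStokesRegularity.EnergySupercriticality: it applies to the GOAL (crux 2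
is a critical a-priori bound) and is not
claimed free; the dimension count is explicit — the energy (dimension L¹) is the c-INTEGRAL of the
critical planar energy (L⁰), so the whole
supercritical gap is concentrated in one operation, sup over the offset c of an L¹(dc) profile
governed by a 1-D heat law; cruxes 3 and the
zoom use no energy bound at all.
- Literature.Barriers.NavierStokesRegularity.NavierStokesInequalitySingularSolution: evaded —
Scheffer/Ożański solutions satisfy only the
local energy INEQUALITY with a hidden sink/force; the slab law is the EQUALITY (the flux F and the
sink D are exactly those of a true
solution), and the Liouville crux is posed in the mild (duality) class, not for suitable weak
solutions.
- Literature.Barriers.NavierStokesRegularity.CriticalNormBlowupNecessity: consistent and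
complementary — bounded planar energy neither
implies nor f

History (route lifecycle, newest last):
- 2026-08-16T21:31:29Z · rev 6: restated Assembly (stmt-NavierStokesRegularity-16862) — route-repair follow-up: Assembly restated to mirror the certified closes (APriori → BoundedPlanarEnergyNoBlowup → Statement); the old 3-hypothesis chain is the (planner-rbadge-NavierStokesRegularity-PlaneEne-46b3d9a6-0)
- 2026-08-16T21:39:37Z · rev 10: restated Assembly (stmt-NavierStokesRegularity-16912) — route-repair (cone), step 4: restate the Assembly item 1:1 to mirror the certified A-form deciding theorem (PlanarEnergyAPriori → BoundedPlanarEnergyRegularity (planner-rrepair-NavierStokesRegularity-PlaneEn-46b3d9a6-0)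
- 2026-08-16T21:41:02Z · rev 11: restated Target (stmt-NavierStokesRegularity-16854) — route-repair (cone), step 5a: restate Target 1:1 into the Clay (A)-form conjunction X = PlanarEnergyAPriori ∧ BoundedPlanarEnergyRegularity (both conjuncts inli (planner-rrepair-NavierStokesRegularity-PlaneEn-46b3d9a6-0)
- 2026-08-16T21:43:15Z · rev 12: dropped BoundedPlanarEnergyNoBlowup, NoBlowupToClay — route-repair (cone), step 5b — RE-ROUTED AROUND the 26 unproved named facts: (1) imports := ClassicalSolution, LerayHopf, SelfSimilar, VectorCalculus, NSWave0 — (planner-rrepair-NavierStokesRegularity-PlaneEn-46b3d9a6-0)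
- 2026-08-17T09:03:57Z · rev 16: restated Assembly (stmt-NavierStokesRegularity-16931) — route-repair (unused-crux): 1 glued / 1 dropped — PlanarEnergyLiouville GLUED into `closes` (hypotheses now PlanarEnergyAPriori, PlanarEnergyLiouville, PlanarEn (planner-rrepair-NavierStokesRegularity-PlaneEn-8a1b3d2f-0)
- 2026-08-17T09:03:57Z · rev 16: dropped PlanarEnergyDataBound, APrioriOfDataBound — route-repair (unused-crux): 1 glued / 1 dropped — PlanarEnergyLiouville GLUED into `closes` (hypotheses now PlanarEnergyAPriori, PlanarEnergyLiouville, PlanarEn (planner-rrepair-NavierStokesRegularity-PlaneEn-8a1b3d2f-0)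
- 2026-08-24T09:58:41Z · DORMANT — reconciler: no traction for 6.7 d (last activity item-evidence-added at 2026-08-17T16:57:41Z); parked, not closed — `ledger route dormant route-NavierStokesRegu (operator:999:1137047)

sub-problem: NavierStokesRegularity · status: dormant · opened planner-plan-novel-NavierStokesRegularity-Navie-a989c6c0-v2-g8-0 2026-08-16T21:13:48Z · rev 17 · ledger route-NavierStokesRegularity-PlaneEnergyCeiling
GENERATED by the gate from the ledger (D-0016/17). Provers cite these decls: `theorem foo : Summit.NavierStokesRegularity.NavierStokesRegularity.Theses.PlaneEnergyCeiling.<Decl> := …` in Summits/NavierStokesRegularity/NavierStokesRegularity/Theorems/<Name>.lean.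
-/

namespace Summit.NavierStokesRegularity.NavierStokesRegularity.Theses.PlaneEnergyCeiling

open scoped BigOperators Topology Manifold Classical MeasureTheory ProbabilityTheory Matrix InnerProductSpace ComplexConjugate ContinuousMap
open Filter Set Function TopologicalSpace MeasureTheory

attribute [summit_statement] _root_.NavierStokesRegularity

open Literature.NS

-- earlier Target (stmt-NavierStokesRegularity-16854, replaced 2026-08-16T21:41:02Z -> stmt-NavierStokesRegularity-16932): retired by None — (∀ (ν T : ℝ), 0 < ν → 0 < T → ∀ (u : ℝ → EuclideanSpace ℝ (Fin 3) → EuclideanSpace ℝ (Fin 3)) (p : ℝ → EuclideanSpace ℝ (Fin 3) → ℝ), Literature.Analysis.FluidPDE.IsClassicalNSSolutionOn (Set.Ico 0 T) ν 0 u p → Literature.Analysis.FluidPDE.IsLerayHopfOn T ν 0 (u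
/-- item stmt-NavierStokesRegularity-16932 · target · rank 0 · open · by planner
why it might fail: (i) is a critical a-priori bound: Type-II blow-up or a collapsing energy SHEET fed by colliding streams breaks it; (ii) contains an unproved Liouville theorem in the Ṁ^{2,3}-type class where Type-I profiles almost live — a blow-up from Fefferman data with bounded planar energies kills it.
sources: KNSS2009, CaffarelliKohnNirenberg1982, EscauriazaSereginSverak2003, arXiv:1705.04561, arXiv:1806.03003, Fefferman2000
[target] X = PlanarEnergyAPriori ∧ BoundedPlanarEnergyRegularity (Clay (A)-form; `Target ↔
PlanarEnergyAPriori ∧ BoundedPlanarEnergyRegularity` is Iff.rfl and `closes` is literally "X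
suffices"): (i) every classical Leray–Hopf solution from a rapidly decaying datum on [0,T) has
planar kinetic energy ∫_{R({x₂=c})}|u(t)|² dA bounded over all planes and all t < T; (ii) for every
ν > 0 and every smooth divergence-free rapidly decaying datum u₀, if every classical Leray–Hopf
solution from u 0 = u₀ has bounded planar energies on its interval [0,T) (all T), then Clay (A)
holds for u₀ (smooth global solution with bounded energy). (ii) is the per-datum A-form of the
extension-form criterion "bounded planar energy ⇒ smooth extension past T" (the earlier second
conjunct), which it contains together with the per-datum local Clay theory. -/
@[route_item "route-NavierStokesRegularity-PlaneEnergyCeiling"]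
def Target : Prop :=
  (∀ (ν T : ℝ), 0 < ν → 0 < T → ∀ (u : ℝ → EuclideanSpace ℝ (Fin 3) → EuclideanSpace ℝ (Fin 3)) (p : ℝ → EuclideanSpace ℝ (Fin 3) → ℝ), Literature.Analysis.FluidPDE.IsClassicalNSSolutionOn (Set.Ico 0 T) ν 0 u p → Literature.Analysis.FluidPDE.IsLerayHopfOn T ν 0 (u 0) u → Literature.Analysis.FluidPDE.HasRapidSpatialDecay (u 0) → ∃ M : ℝ, ∀ t ∈ Set.Ico 0 T, ∀ (R : EuclideanSpace ℝ (Fin 3) ≃ₗᵢ[ℝ] EuclideanSpace ℝ (Fin 3)) (c : ℝ), ∫⁻ y : EuclideanSpace ℝ (Fin 2), ‖u t (R (WithLp.toLp 2 ![y 0, y 1, c]))‖ₑ ^ 2 ≤ ENNReal.ofReal M) ∧ (∀ (ν : ℝ), 0 < ν → ∀ (u₀ : EuclideanSpace ℝ (Fin 3) → EuclideanSpace ℝ (Fin 3)), ContDiff ℝ (⊤ : ℕ∞) u₀ → Literature.Analysis.FluidPDE.NSWave0.IsDivFree u₀ → Literature.Analysis.FluidPDE.HasRapidSpatialDecay u₀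 → (∀ (T : ℝ), 0 < T → ∀ (u : ℝ → EuclideanSpace ℝ (Fin 3) → EuclideanSpace ℝ (Fin 3)) (p : ℝ → EuclideanSpace ℝ (Fin 3) → ℝ), Literature.Analysis.FluidPDE.IsClassicalNSSolutionOn (Set.Ico 0 T) ν 0 u p → Literature.Analysis.FluidPDE.IsLerayHopfOn T ν 0 (u 0) u → u 0 = u₀ → ∃ M : ℝ, ∀ t ∈ Set.Ico 0 T, ∀ (R : EuclideanSpace ℝ (Fin 3) ≃ₗᵢ[ℝ] EuclideanSpace ℝ (Fin 3)) (c : ℝ), ∫⁻ y : EuclideanSpace ℝ (Fin 2), ‖u t (R (WithLp.toLp 2 ![y 0, y 1, c]))‖ₑ ^ 2 ≤ ENNReal.ofReal M) → ∃ (u : ℝ → EuclideanSpace ℝ (Fin 3) → EuclideanSpace ℝ (Fin 3)) (p : ℝ → EuclideanSpace ℝ (Fin 3) → ℝ), Literature.Analysis.FluidPDE.IsSmoothOnHalfSpace u ∧ Literature.Analysis.FluidPDE.IsSmoothOnHalfSpace p ∧ Literature.Analysis.FluidPDE.IsNavierStokesSolution ν 0 u₀ u p ∧ Literature.Analysis.FluidPDE.HasBoundedEnergy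 u)

/-- item stmt-NavierStokesRegularity-16855 · crux · rank 2 · open · by planner
why it might fail: critical a-priori estimate that already implies Type-II exclusion in the scaled-energy sense (forces u ∈ L^∞_t Ṁ^{2,3}); a Type-II singularity, or energy focusing onto a sheet by colliding jets faster than viscosity thickens it (ring collision pumps Γ²R/h), breaks it.
sources: CaffarelliKohnNirenberg1982, arXiv:1108.1165, arXiv:1705.04561, SereginSverak2009, Hou2022PotentiallySingularNS, LemarieRieusset2016
[crux] PLANAR ENERGY CEILING (per-solution form): for every ν > 0, T > 0 and every classical
solution (u,p) of unforced NS on ℝ³×[0,T) that is Leray–Hopf from a rapidly decaying datum u(0),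
there is M with ∫_{R({x₂=c})} |u(t)|² dA ≤ M for all t ∈ [0,T), all linear isometries R and all
heights c. By the slab law it suffices to control the convergence −∂_cF of the Bernoulli flux at the
maximising plane against ν∂²_cE and the sink 2νD (attack: split F into the a-priori-bounded smoothed
flux ledger plus an oscillation paid by planar dissipation; a peak of height E* has width ≤ 2E₀/E*,
so it must be fed through a slab thinner than the parabolic scale). [difficulty: open-problem] -/
@[route_item "route-NavierStokesRegularity-PlaneEnergyCeiling", crux]
def PlanarEnergyAPriori : Prop :=
  ∀ (ν T : ℝ), 0 < ν → 0 < T → ∀ (u : ℝ → EuclideanSpace ℝ (Fin 3) → EuclideanSpace ℝ (Fin 3)) (p : ℝ → EuclideanSpace ℝ (Fin 3) → ℝ), Literature.Analysis.FluidPDE.IsClassicalNSSolutionOn (Set.Ico 0 T) ν 0 u p → Literature.Analysis.FluidPDE.IsLerayHopfOn T ν 0 (u 0) u → Literature.Analysis.FluidPDE.HasRapidSpatialDecay (u 0) → ∃ M : ℝ, ∀ t ∈ Set.Ico 0 T, ∀ (R : EuclideanSpace ℝ (Fin 3) ≃ₗᵢ[ℝ] EuclideanSpace ℝ (Fin 3))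 (c : ℝ), ∫⁻ y : EuclideanSpace ℝ (Fin 2), ‖u t (R (WithLp.toLp 2 ![y 0, y 1, c]))‖ₑ ^ 2 ≤ ENNReal.ofReal M

/-- item stmt-NavierStokesRegularity-16856 · crux · rank 3 · open · by planner
why it might fail: bounded planar energy gives Ṁ^{2,3}-boundedness but no smallness at infinity, so the time-dependent case is a Type-I-type Liouville problem; a bounded ancient two-sided jet fed from infinity with L² cross-sections, or a Type-I ancient flow with sub-|y|⁻¹ planar tails, refutes it.
sources: KNSS2009, SereginSverak2009, arXiv:1806.03003, arXiv:2005.09691, AlbrittonBarker2019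
[crux] LIOUVILLE IN THE PLANAR-ENERGY CLASS: a bounded ancient mild solution v of NS (ν = 1) on
ℝ³×(−∞,0) (KNSS duality-form class IsBoundedAncientMildSolution 1 v, measurable slices), jointly
smooth on (−∞,0)×ℝ³, whose planar kinetic energies ∫_{R({x₂=c})}|v(t)|² dA are bounded uniformly in
t, R, c, is identically zero. Weaker than KNSS (L) (stmt-10661): constants and parasitic drifts are
excluded by the hypothesis; free structure: v ∈ L^∞_t Ṁ^{2,3} with |v| ≤ C, |y|⁻¹ far-field germs
excluded (log-divergent planar energy), steady corner PROVED (bounded + Ṁ^{2,3} steady ⇒ 0), 2-D /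
axisymmetric-no-swirl corners KNSS, finite-energy corner elementary. [difficulty: open-problem] -/
@[route_item "route-NavierStokesRegularity-PlaneEnergyCeiling", crux]
def PlanarEnergyLiouville : Prop :=
  ∀ (v : ℝ → EuclideanSpace ℝ (Fin 3) → EuclideanSpace ℝ (Fin 3)), Literature.Analysis.FluidPDE.IsBoundedAncientMildSolution 1 v → (∀ t < 0, MeasureTheory.AEStronglyMeasurable (v t) MeasureTheory.volume) → ContDiffOn ℝ (⊤ : ℕ∞) (Function.uncurry v) (Set.Iio 0 ×ˢ Set.univ) → (∃ M : ℝ, ∀ t < 0, ∀ (R : EuclideanSpace ℝ (Fin 3) ≃ₗᵢ[ℝ] EuclideanSpace ℝ (Fin 3)) (c : ℝ), ∫⁻ y : EuclideanSpace ℝ (Fin 2), ‖v t (R (WithLp.toLp 2 ![y 0, y 1, c]))‖ₑ ^ 2 ≤ ENNReal.ofReal M) → ∀ t < 0, ∀ x, v t x = 0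

/-- item stmt-NavierStokesRegularity-16921 · crux · rank 3 · open · by planner
why it might fail: A-form of the large-norm p = ∞ anisotropic-LPS endpoint: a planar bound gives bounded CKN scaled energy but no smallness or decay across planes, so it contains the OPEN Type-I-in-energy exclusion (planar log-gain only) and the Liouville crux; a blow-up with bounded planar energies kills it.
sources: arXiv:1901.01510, KNSS2009, AlbrittonBarker2019, SereginSverak2009, EscauriazaSereginSverak2003, Fefferman2000
[crux] BOUNDED PLANAR ENERGY ⇒ CLAY REGULARITY, (A)-FORM (per datum; the second hypothesis of
`closes`, superseding the extension-form BoundedPlanarEnergyNoBlowup so that the deciding theorem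
needs no frame theorem and no Theorems import): for every ν > 0 and every smooth, divergence-free,
rapidly decaying datum u₀ on ℝ³ — IF every classical solution (u,p) of unforced NS on ℝ³×[0,T) that
is Leray–Hopf from u 0 = u₀ has planar kinetic energies ∫_{R({x₂=c})}|u(t)|² dA bounded uniformly in
t < T, R, c (for every T > 0), THEN Clay (A) holds for u₀: there are u, p smooth on ℝ³×[0,∞) solving
NS with datum u₀ and bounded energy. Content = BoundedPlanarEnergyNoBlowup (large-norm p = ∞
endpoint of the anisotropic LPS scale over all directions: bounded planar energy ⇒ smooth extension)
+ the per-datum local Clay theory (Kato classical Leray–Hopf solution from Fefferman data, C^∞ up to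
t = 0, blow-up alternative, energy inequality — proved in tree, but only inside cone-dirty modules).
Reached through the glued split PlanarEnergyLiouville → PlanarEnergyZoomA →
BoundedPlanarEnergyRegularity (pure logic, certified in the planner's Sketch.lean). [deps:
PlanarEnergyLiouville, PlanarEnergyZoomA] [d -/
@[route_item "route-NavierStokesRegularity-PlaneEnergyCeiling"]
def BoundedPlanarEnergyRegularity : Prop :=
  ∀ (ν : ℝ), 0 < ν → ∀ (u₀ : EuclideanSpace ℝ (Fin 3) → EuclideanSpace ℝ (Fin 3)), ContDiff ℝ (⊤ : ℕ∞) u₀ → Literature.Analysis.FluidPDE.NSWave0.IsDivFree u₀ → Literature.Analysis.FluidPDE.HasRapidSpatialDecay u₀ → (∀ (T : ℝ), 0 < T → ∀ (u : ℝ → EuclideanSpace ℝ (Fin 3) → EuclideanSpace ℝ (Fin 3)) (p : ℝ → EuclideanSpace ℝ (Fin 3) → ℝ), Literature.Analysis.FluidPDE.IsClassicalNSSolutionOn (Set.Ico 0 T) ν 0 u p → Literature.Analysis.FluidPDE.IsLerayHopfOn T ν 0 (u 0) u → u 0 = u₀ → ∃ M : ℝ, ∀ t ∈ Set.Ico 0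 T, ∀ (R : EuclideanSpace ℝ (Fin 3) ≃ₗᵢ[ℝ] EuclideanSpace ℝ (Fin 3)) (c : ℝ), ∫⁻ y : EuclideanSpace ℝ (Fin 2), ‖u t (R (WithLp.toLp 2 ![y 0, y 1, c]))‖ₑ ^ 2 ≤ ENNReal.ofReal M) → ∃ (u : ℝ → EuclideanSpace ℝ (Fin 3) → EuclideanSpace ℝ (Fin 3)) (p : ℝ → EuclideanSpace ℝ (Fin 3) → ℝ), Literature.Analysis.FluidPDE.IsSmoothOnHalfSpace u ∧ Literature.Analysis.FluidPDE.IsSmoothOnHalfSpace p ∧ Literature.Analysis.FluidPDE.IsNavierStokesSolution ν 0 u₀ u p ∧ Literature.Analysis.FluidPDE.HasBoundedEnergy u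

/-- item stmt-NavierStokesRegularity-16915 · crux · rank 5 · closed · proved by Summit.NavierStokesRegularity.NavierStokesRegularity.Theorems.planarEnergyZoomA_proof @ 61103d5bf9a7 (prover) · by planner
why it might fail: Load-bearing AS TYPED: the Kato solution from Fefferman data must be C^∞ up to t = 0 with the IsNavierStokesSolution pressure, and the duality-form mild identity, joint smoothness and the planar bound on EVERY plane (Fatou) must survive the KNSS record zoom; in tree only KNSS Prop 6.1.
sources: KNSS2009, SereginSverak2009, AlbrittonBarker2019, Fefferman2000, Kato1984
[crux] VELOCITY-RECORD ZOOM AT BOUNDED PLANAR ENERGY, CLAY (A)-FORM (per datum; the closing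
hypothesis that replaces PlanarEnergyZoom + the invoked frame theorem): for ν > 0 and a smooth
divergence-free rapidly decaying datum u₀, if every classical solution (u,p) of unforced NS on
ℝ³×[0,T) that is Leray–Hopf from u 0 = u₀ has planar kinetic energies ∫_{R({x₂=c})}|u(t)|² dA
bounded on [0,T) (all T), and Clay (A) FAILS for u₀ (no smooth bounded-energy global solution from
u₀), then there is a bounded ancient mild solution v of NS (ν = 1, KNSS duality class), measurable
slices, jointly smooth on (−∞,0)×ℝ³, with planar energies bounded uniformly in t, R, c, and v ≢ 0.
Route to it: the Kato classical Leray–Hopf solution from u₀ is smooth up to t = 0 and has bounded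
energy, so ¬(A) forces a finite maximal time T* with sup|u| → ∞ (bounded velocity ⇒ extension); the
planar bound holds on [0,T*) by hypothesis; the KNSS zoom at near-record points (KNSS2009 Prop 6.1,
in tree as KNSS2009_blowup_generates_ancient / IsKNSSBlowupLimit), normalised to ν = 1 by u ↦
ν⁻¹u(x,t/ν), gives v with sup|v| = 1, and the scale-invariant planar bound passes to the limit by
Fatou under locally uniform convergen -/
@[route_item "route-NavierStokesRegularity-PlaneEnergyCeiling", crux]
def PlanarEnergyZoomA : Prop :=
  ∀ (ν : ℝ), 0 < ν → ∀ (u₀ : EuclideanSpace ℝ (Fin 3) → EuclideanSpace ℝ (Fin 3)), ContDiff ℝ (⊤ : ℕ∞) u₀ → Literature.Analysis.FluidPDE.NSWave0.IsDivFree u₀ → Literature.Analysis.FluidPDE.HasRapidSpatialDecay u₀ → (∀ (T : ℝ), 0 < T → ∀ (u : ℝ → EuclideanSpace ℝ (Fin 3) → EuclideanSpace ℝ (Fin 3)) (p : ℝ → EuclideanSpace ℝ (Fin 3) → ℝ), Literature.Analysis.FluidPDE.IsClassicalNSSolutionOn (Set.Ico 0 T) ν 0 u p → Literature.Analysis.FluidPDE.IsLerayHopfOn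 T ν 0 (u 0) u → u 0 = u₀ → ∃ M : ℝ, ∀ t ∈ Set.Ico 0 T, ∀ (R : EuclideanSpace ℝ (Fin 3) ≃ₗᵢ[ℝ] EuclideanSpace ℝ (Fin 3)) (c : ℝ), ∫⁻ y : EuclideanSpace ℝ (Fin 2), ‖u t (R (WithLp.toLp 2 ![y 0, y 1, c]))‖ₑ ^ 2 ≤ ENNReal.ofReal M) → ¬ (∃ (u : ℝ → EuclideanSpace ℝ (Fin 3) → EuclideanSpace ℝ (Fin 3)) (p : ℝ → EuclideanSpace ℝ (Fin 3) → ℝ), Literature.Analysis.FluidPDE.IsSmoothOnHalfSpace u ∧ Literature.Analysis.FluidPDE.IsSmoothOnHalfSpace p ∧ Literature.Analysis.FluidPDE.IsNavierStokesSolution ν 0 u₀ u p ∧ Literature.Analysis.FluidPDE.HasBoundedEnergy u) → ∃ (v : ℝ → EuclideanSpace ℝ (Fin 3) → EuclideanSpace ℝ (Fin 3)) (M' : ℝ), Literature.Analysis.FluidPDE.IsBoundedAncientMildSolution 1 v ∧ (∀ t < 0, MeasureTheory.AEStronglyMeasurable (v t) MeasureTheory.volume) ∧ ContDiffOn ℝ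 (⊤ : ℕ∞) (Function.uncurry v) (Set.Iio 0 ×ˢ Set.univ) ∧ (∀ t < 0, ∀ (R : EuclideanSpace ℝ (Fin 3) ≃ₗᵢ[ℝ] EuclideanSpace ℝ (Fin 3)) (c : ℝ), ∫⁻ y : EuclideanSpace ℝ (Fin 2), ‖v t (R (WithLp.toLp 2 ![y 0, y 1, c]))‖ₑ ^ 2 ≤ ENNReal.ofReal M') ∧ ∃ t < 0, ∃ x, v t x ≠ 0

/-- item stmt-NavierStokesRegularity-16858 · support · rank 9 · closed · proved by Summit.NavierStokesRegularity.NavierStokesRegularity.Theorems.planarEnergyZoom_proof @ d47eb328cb22 (prover) · by planner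
why it might fail: velocity-clock zoom in the duality-form mild class: the limit must keep the mild identity, joint smoothness AND the planar bound for every direction and offset (Fatou plane by plane along the KNSS extraction) while near-record points drift; only the plain KNSS Prop 6.1 version is in tree.
sources: KNSS2009, SereginSverak2009, AlbrittonBarker2019
[support] VELOCITY-RECORD ZOOM AT BOUNDED PLANAR ENERGY (glue of BoundedPlanarEnergyNoBlowup, used
by `closes`): if a classical Leray–Hopf solution from a rapidly decaying datum has no smooth
extension past T while its planar energies stay ≤ M on [0,T), then (bounded velocity ⇒ extension,
in-tree hasSmoothExtensionPast_of_bounded_holds, so velocity records diverge) the KNSS zoom at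
near-record points (KNSS2009 Prop 6.1, in tree as KNSS2009_blowup_generates_ancient /
IsKNSSBlowupLimit), after normalising ν = 1 by u ↦ ν⁻¹u(x,t/ν), yields a bounded ancient mild
solution v (ν = 1), measurable and jointly smooth, with sup|v| = 1 (hence v ≢ 0) and planar energies
≤ M/ν² on every plane and slice (exact scale invariance of E + Fatou under locally uniform
convergence). [difficulty: L] -/
@[route_item "route-NavierStokesRegularity-PlaneEnergyCeiling", crux]
def PlanarEnergyZoom : Prop :=
  ∀ (ν T : ℝ), 0 < ν → 0 < T → ∀ (u : ℝ → EuclideanSpace ℝ (Fin 3) → EuclideanSpace ℝ (Fin 3)) (p : ℝ → EuclideanSpace ℝ (Fin 3) → ℝ), Literature.Analysis.FluidPDE.IsClassicalNSSolutionOn (Set.Ico 0 T) ν 0 u p → Literature.Analysis.FluidPDE.IsLerayHopfOn T ν 0 (u 0) u → Literature.Analysis.FluidPDE.HasRapidSpatialDecay (u 0) → ¬ Literature.Analysis.FluidPDE.HasSmoothExtensionPast ν 0 u T → (∃ M : ℝ, ∀ t ∈ Set.Ico 0 T, ∀ (R : EuclideanSpace ℝ (Fin 3) ≃ₗᵢ[ℝ]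 EuclideanSpace ℝ (Fin 3)) (c : ℝ), ∫⁻ y : EuclideanSpace ℝ (Fin 2), ‖u t (R (WithLp.toLp 2 ![y 0, y 1, c]))‖ₑ ^ 2 ≤ ENNReal.ofReal M) → ∃ (v : ℝ → EuclideanSpace ℝ (Fin 3) → EuclideanSpace ℝ (Fin 3)) (M' : ℝ), Literature.Analysis.FluidPDE.IsBoundedAncientMildSolution 1 v ∧ (∀ t < 0, MeasureTheory.AEStronglyMeasurable (v t) MeasureTheory.volume) ∧ ContDiffOn ℝ (⊤ : ℕ∞) (Function.uncurry v) (Set.Iio 0 ×ˢ Set.univ) ∧ (∀ t < 0, ∀ (R : EuclideanSpace ℝ (Fin 3) ≃ₗᵢ[ℝ] EuclideanSpace ℝ (Fin 3)) (c : ℝ), ∫⁻ y : EuclideanSpace ℝ (Fin 2), ‖v t (R (WithLp.toLp 2 ![y 0, y 1, c]))‖ₑ ^ 2 ≤ ENNReal.ofReal M') ∧ ∃ t < 0, ∃ x, v t x ≠ 0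

/-- item stmt-NavierStokesRegularity-16859 · support · rank 9 · closed · proved by Summit.NavierStokesRegularity.NavierStokesRegularity.Theorems.planeEnergyCeiling_slabEnergyIdentity @ 94eb4949f6a2 (prover) · by planner
sources: CaffarelliKohnNirenberg1982, LemarieRieusset2016, MajdaBertozzi2002
[support] THE SLAB ENERGY IDENTITY (provable now; a kinematic identity, no NS solution and no
pressure Poisson equation needed): for any real ν, any a < b, any smooth rapidly decaying
divergence-free u and smooth rapidly decaying scalar p on ℝ³, with the tendency field acc := νΔu −
(u·∇)u − ∇p, flux F(c) := ∫_{x₂=c}(|u|²/2 + p)u₂ dA and boundary term B(c) := ∫_{x₂=c}⟪u,∂₂u⟫ dA: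
∫_{a<x₂<b} 2⟪u,acc⟫ dx = 2ν(B(b) − B(a)) − 2ν∫_{a<x₂<b}|∇u|² dx − 2(F(b) − F(a)). Along a classical
solution ∂ₜ|u|² = 2⟪u,acc⟫, so this is the integrated form of ∂ₜE = ν∂²_cE − 2∂_cF − 2νD.
[difficulty: provable-now] -/
@[route_item "route-NavierStokesRegularity-PlaneEnergyCeiling"]
def SlabEnergyIdentity : Prop :=
  ∀ (ν a b : ℝ), a < b → ∀ (u : EuclideanSpace ℝ (Fin 3) → EuclideanSpace ℝ (Fin 3)) (p : EuclideanSpace ℝ (Fin 3) → ℝ), ContDiff ℝ (⊤ : ℕ∞) u → ContDiff ℝ (⊤ : ℕ∞) p → Literature.Analysis.FluidPDE.HasRapidSpatialDecay u → Literature.Analysis.FluidPDE.HasRapidSpatialDecay p → Literature.Analysis.FluidPDE.VectorCalculus.IsDivFree u → let acc : EuclideanSpace ℝ (Fin 3) → EuclideanSpace ℝ (Fin 3) := fun x => ν • Laplacian.laplacian u x - Literature.Analysis.FluidPDE.convect u u x - gradient p x; let D3 : (EuclideanSpace ℝ (Fin 3) → EuclideanSpace ℝ (Fin 3)) → EuclideanSpace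 ℝ (Fin 3) → EuclideanSpace ℝ (Fin 3) := fun w x => fderiv ℝ w x (EuclideanSpace.single 2 1); let P : EuclideanSpace ℝ (Fin 2) → ℝ → EuclideanSpace ℝ (Fin 3) := fun y c => WithLp.toLp 2 ![y 0, y 1, c]; let F : ℝ → ℝ := fun c => ∫ y, (‖u (P y c)‖ ^ 2 / 2 + p (P y c)) * u (P y c) 2; let B : ℝ → ℝ := fun c => ∫ y, inner ℝ (u (P y c)) (D3 u (P y c)); (∫ x in {x : EuclideanSpace ℝ (Fin 3) | a < x 2 ∧ x 2 < b}, 2 * inner ℝ (u x) (acc x)) = 2 * ν * (B b - B a) - 2 * ν * (∫ x in {x : EuclideanSpace ℝ (Fin 3) | a < x 2 ∧ x 2 < b}, ∑ j : Fin 3, ‖fderiv ℝ u x (EuclideanSpace.single j 1)‖ ^ 2) - 2 * (F b - F a)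

/-- item stmt-NavierStokesRegularity-16860 · support · rank 9 · closed · proved by Summit.NavierStokesRegularity.NavierStokesRegularity.Theorems.PlanarEnergyAPriori.planeEnergyCeiling_scaledEnergyOfPlanar @ 6409d1d9a569 (prover) · by planner
sources: arXiv:1705.04561, CaffarelliKohnNirenberg1982, SereginSverak2009
[support] PLANAR CEILING ⇒ SCALED-ENERGY CEILING (provable now): if a continuous field w on ℝ³ has
planar energy ≤ M through every plane, then ∫_{B_r(x₀)}|w|² ≤ 2rM for every centre and radius (the
ball lies in the slab |x₂ − (x₀)₂| < r; Tonelli over the coordinate foliation). Hence bounded planar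
energy along a solution means uniformly bounded CKN quantity A(r) at all centres and scales — the
hypothesis of Choe–Yang's reverse-Hölder theorem and of Seregin's Type-I-in-energy class.
[difficulty: provable-now] -/
@[route_item "route-NavierStokesRegularity-PlaneEnergyCeiling"]
def ScaledEnergyOfPlanar : Prop :=
  ∀ (w : EuclideanSpace ℝ (Fin 3) → EuclideanSpace ℝ (Fin 3)), Continuous w → ∀ (M : ℝ), 0 ≤ M → (∀ (R : EuclideanSpace ℝ (Fin 3) ≃ₗᵢ[ℝ] EuclideanSpace ℝ (Fin 3)) (c : ℝ), ∫⁻ y : EuclideanSpace ℝ (Fin 2), ‖w (R (WithLp.toLp 2 ![y 0, y 1, c]))‖ₑ ^ 2 ≤ ENNReal.ofReal M) → ∀ (x₀ : EuclideanSpace ℝ (Fin 3)) (r : ℝ), 0 < r → ∫⁻ x in Metric.ball x₀ r, ‖w x‖ₑ ^ 2 ≤ ENNReal.ofReal (2 * r * M)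

/-- item stmt-NavierStokesRegularity-16861 · support · rank 9 · closed · proved by Summit.NavierStokesRegularity.NavierStokesRegularity.Theorems.SteadyPlanarLiouville.steadyPlanarLiouville_proof @ 280310b22490 (prover) · by planner
sources: arXiv:1806.03003, arXiv:2005.09691, Seregin2016
[support] THE STEADY CORNER OF CRUX 3 (provable from the literature): a smooth bounded
divergence-free steady solution w of (w·∇)w + ∇q = Δw on ℝ³ whose planar energies are bounded on
every plane is identically zero — by ScaledEnergyOfPlanar w ∈ Ṁ^{2,3}, and bounded + Ṁ^{2,3} steady
solutions vanish (Chamorro–Jarrín–Lemarié-Rieusset arXiv:1806.03003 Prop 3.1: w ∈ Ḣ¹ with ‖w‖_{Ḣ¹} ≲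
‖w‖^{1/2}_∞‖w‖_{Ṁ^{2,3}}, then w ∈ L⁴ and their Thm 1; alternatively Tsai arXiv:2005.09691 Thm
1.1(a) with δ = 1, q = 12/5, since R⁻¹‖w‖²_{L^{12/5}(R<|x|<2R)} ≲ R^{-1/6} → 0). [difficulty: M] -/
@[route_item "route-NavierStokesRegularity-PlaneEnergyCeiling"]
def SteadyPlanarLiouville : Prop :=
  ∀ (w : EuclideanSpace ℝ (Fin 3) → EuclideanSpace ℝ (Fin 3)) (q : EuclideanSpace ℝ (Fin 3) → ℝ), ContDiff ℝ (⊤ : ℕ∞) w → ContDiff ℝ (⊤ : ℕ∞) q → Literature.Analysis.FluidPDE.VectorCalculus.IsDivFree w → (∀ x, Literature.Analysis.FluidPDE.convect w w x + gradient q x = Laplacian.laplacian w x) → (∃ K : ℝ, ∀ x, ‖w x‖ ≤ K) → (∃ M : ℝ, ∀ (R : EuclideanSpace ℝ (Fin 3) ≃ₗᵢ[ℝ] EuclideanSpace ℝ (Fin 3)) (c : ℝ), ∫⁻ y : EuclideanSpace ℝ (Fin 2), ‖w (R (WithLp.toLp 2 ![y 0, y 1, c]))‖ₑ ^ 2 ≤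 ENNReal.ofReal M) → ∀ x, w x = 0

/-- item stmt-NavierStokesRegularity-17966 · support · rank 9 · closed · proved by Summit.NavierStokesRegularity.NavierStokesRegularity.Theorems.boundedRegularityOfLiouvilleZoomA_proof @ 7f38d46d8db1 (prover) · by planner
sources: KNSS2009, AlbrittonBarker2019, SereginSverak2009
[support] GLUE, second layer of `closes` (connects crux 3 PlanarEnergyLiouville and the support
PlanarEnergyZoomA to the closing hypothesis BoundedPlanarEnergyRegularity; the foreseen glued split
of the TWO-LAYER PLAN, filed flat): Liouville in the planar-energy class and the (A)-form
velocity-record zoom imply the criterion 'bounded planar energy along every classical Leray–Hopf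
solution from u₀ ⇒ Clay (A) for u₀' — if (A) failed for u₀ under the planar bound, PlanarEnergyZoomA
yields a bounded ancient mild solution (ν = 1), measurable, jointly smooth on (−∞,0)×ℝ³, with
uniformly bounded planar energies and v ≢ 0, contradicting PlanarEnergyLiouville. Pure logic
(by_contra, one application of each hypothesis), certified in the planner's Sketch.lean as
boundedRegularityOfLiouvilleZoomA_proof (lean check rc 0, 0 sorry, axioms
propext/Classical.choice/Quot.sound); provable now in four lines. [glue] [deps:
PlanarEnergyLiouville, PlanarEnergyZoomA, BoundedPlanarEnergyRegularity] [difficulty: provable-now] -/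
@[route_item "route-NavierStokesRegularity-PlaneEnergyCeiling"]
def BoundedRegularityOfLiouvilleZoomA : Prop :=
  PlanarEnergyLiouville → PlanarEnergyZoomA → BoundedPlanarEnergyRegularity

-- earlier Assembly (stmt-NavierStokesRegularity-16862, replaced 2026-08-16T21:31:29Z -> stmt-NavierStokesRegularity-16912): retired by None — PlanarEnergyAPriori → PlanarEnergyLiouville → PlanarEnergyZoom → NavierStokesRegularity
-- earlier Assembly (stmt-NavierStokesRegularity-16912, replaced 2026-08-16T21:39:37Z -> stmt-NavierStokesRegularity-16931): retired by None — PlanarEnergyAPriori → BoundedPlanarEnergyNoBlowup → NavierStokesRegularity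
-- earlier Assembly (stmt-NavierStokesRegularity-16931, replaced 2026-08-17T09:03:57Z -> stmt-NavierStokesRegularity-17948): retired by None — PlanarEnergyAPriori → BoundedPlanarEnergyRegularity → NavierStokesRegularity
/-- item stmt-NavierStokesRegularity-17948 · assembly · rank 1 · closed · proved by Summit.NavierStokesRegularity.NavierStokesRegularity.Theorems.planeEnergyCeiling_assembly_proof @ 8a577e7989af (prover) · by planner
sources: Fefferman2000, KNSS2009
[assembly] PlanarEnergyAPriori → PlanarEnergyLiouville → PlanarEnergyZoomA → NavierStokesRegularity
(mirrors the certified 3-hypothesis `closes`: the second layer PlanarEnergyLiouville +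
PlanarEnergyZoomA ⇒ BoundedPlanarEnergyRegularity is derived INSIDE `closes` by pure logic
(by_contra: the zoom's nonzero bounded ancient mild solution with bounded planar energies
contradicts the Liouville theorem), then the A-form argument datum by datum; provable by `fun h₁ h₃
h₅ => closes h₁ h₃ h₅`). -/
@[route_item "route-NavierStokesRegularity-PlaneEnergyCeiling"]
def Assembly : Prop :=
  PlanarEnergyAPriori → PlanarEnergyLiouville → PlanarEnergyZoomA → NavierStokesRegularity

/-! D-0027 §2.1 — DECIDING THEOREM (planner-authored via `route open/edit --closes-file`; by planner-rrepair-NavierStokesRegularity-PlaneEn-8a1b3d2f-0 2026-08-17T09:03:57Z):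
its hypotheses are this route's items and its conclusion the sub-problem Statement (glue_lint), and it elaborates with this file. -/

@[closes "route-NavierStokesRegularity-PlaneEnergyCeiling"] theorem closes (h₁ : PlanarEnergyAPriori) (h₃ : PlanarEnergyLiouville) (h₅ : PlanarEnergyZoomA) :
    NavierStokesRegularity :=
  -- SECOND LAYER (pure logic, load-bearing): Liouville in the planar-energy class + the (A)-form velocity-record
  -- zoom give the closing criterion crux BoundedPlanarEnergyRegularity — if Clay (A) failed for u₀ under the planar
  -- bound, the zoom would deliver a nonzero bounded ancient mild solution with bounded planar energies, which the
  -- Liouville theorem forces to vanish. (Also filed as the support item BoundedRegularityOfLiouvilleZoomA.)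
  have h₂ : BoundedPlanarEnergyRegularity := by
    intro ν hν u₀ hu₀ hdiv hdec hpl
    by_contra hA
    obtain ⟨v, M', hm, hmeas, hsm, hpb, t, ht, x, hx⟩ := h₅ ν hν u₀ hu₀ hdiv hdec hpl hA
    exact hx (h₃ v hm hmeas hsm ⟨M', hpb⟩ t ht x)
  -- FIRST LAYER (the A-form argument of revs 7–14): datum by datum, crux 2 supplies the planar bound along every
  -- classical Leray–Hopf solution from u₀, and the criterion turns it into Clay (A) for u₀.
  fun ν hν u₀ hu₀ hdiv hdec =>
    h₂ ν hν u₀ hu₀ hdiv hdec (fun T hT u p hcl hLH h0 => h₁ ν T hν hT u p hcl hLH (h0 ▸ hdec))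

end Summit.NavierStokesRegularity.NavierStokesRegularity.Theses.PlaneEnergyCeiling
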